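import Mathlib

/-!
# T5DatumSimilitude — the arithmetic of the explicit datum of Lemma N.2 (Tier-5 sub-step N2)

Kernel witnesses, in two elementary MODELS, for the sign / determinant / similitude arithmetic
that route/T5-N2-route-3.md carries out by hand in N2.1(b) (Lemma N.2) and in the rows
N2.2.6, N2.2.8, N2.2.9, N2.2.11, N2.2.12.

* **Star-ring model.** `E` is a field with a `StarRing` structure (the CM field with its complex
  conjugation); an element `u` with `star u = u` plays `u ∈ F⁺ˣ`, an element `δ` with
  `star δ = -δ` plays a trace-zero element.  A line `E·e` carries the form `⟨x e, y e⟩ = x ȳ e`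
  (`lineForm`), the orthogonal sum `⟨e⟩ ⊥ ⟨e'⟩` is `E × E` with `pairForm e e'`, and the map
  `g0 u : (x, y) ↦ (u⁻¹ x, y)` is a similitude of multiplier `u⁻¹` from `pairForm e e'` to
  `pairForm (u e) (u⁻¹ e')` — the explicit `g₀ : W_A → W_B` of row N2.2.11, with
  `e₁₀₁ = u e₁₁₁`, `e₁₁₀ = u⁻¹ e₁₀₀`.  The determinant identities of row N2.2.9 are the
  one-line computations `det_scaled` / `det_scaled_eq`.
* **Sign-vector model.** A CM type of the cyclic sextic field on its three complex places is a
  bit-string `Fin 3 → Bool` (bit `true` at `j` = the chosen representative `τ_j` belongs to the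
  type, `false` = `τ̄_j` does); the real sign vector of a trace-zero element is `Fin 3 → SignType`.
  The sign side of Liu's Def. 4.12 for a representative reads `s j = neg ↔ t j = true`
  (`Admissible`), the signature of `⟨e⟩ ⊥ ⟨e'⟩` at the real place `j` is the pair
  (#positive, #negative) among `(s j, s' j)` (`signature`), and every concrete claim of the rows
  (the four admissibilities, the signatures `(0,2), (1,1), (1,1)` for BOTH pairs, «`u < 0`
  exactly at `ι₂`») is decided by the kernel.  `signVec` ties the model to real numbers:
  the sign vector of a product is the product of the sign vectors (`sign_mul`), and inversion
  does not change it (the multiplier `ν(g) = u⁻¹` has the signs of `u`).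

Nothing here is about an actual number field or an actual hermitian space over it: the two
models record exactly the arithmetic that the prose rows perform.  No Literature fact is
asserted; this file is a record witness behind lines already on the record.
-/

namespace Summit.Ventures.HodgeRepro2.T5DatumSimilitude

/-! ## 1. The star-ring model: lines, pairs, the similitude `g₀`, determinants -/

section StarRingModel

variable {E : Type*} [Field E] [StarRing E]

/-- The form `⟨x e, y e⟩ = x ȳ e` on the line `E·e`, in the coordinates `x, y`. -/
def lineForm (e x y : E) : E := x * star y * e

/-- The orthogonal sum `⟨e⟩ ⊥ ⟨e'⟩` on `E × E`: `⟨(x, y), (x', y')⟩ = x x̄' e + y ȳ' e'`. -/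
def pairForm (e e' : E) (v w : E × E) : E := lineForm e v.1 w.1 + lineForm e' v.2 w.2

/-- The map `g₀ : x e + y e' ↦ (u⁻¹ x)(u e) + y (u⁻¹ e')` of row N2.2.11, in coordinates. -/
def g0 (u : E) (v : E × E) : E × E := (u⁻¹ * v.1, v.2)

omit [StarRing E] in
/-- First coordinate of `g₀`. -/
@[simp] theorem g0_fst (u : E) (v : E × E) : (g0 u v).1 = u⁻¹ * v.1 := rfl

omit [StarRing E] in
/-- Second coordinate of `g₀`. -/
@[simp] theorem g0_snd (u : E) (v : E × E) : (g0 u v).2 = v.2 := rfl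

omit [StarRing E] in
/-- `g₀` is additive. -/
theorem g0_add (u : E) (v w : E × E) : g0 u (v + w) = g0 u v + g0 u w := by
  ext <;> simp [g0, mul_add]

omit [StarRing E] in
/-- `g₀` is `E`-linear. -/
theorem g0_smul (u c : E) (v : E × E) : g0 u (c • v) = c • g0 u v := by
  ext <;> simp [g0, smul_eq_mul, mul_left_comm]

/-- `g₀` as an `E`-linear map `E × E →ₗ[E] E × E`. -/
def g0Linear (u : E) : E × E →ₗ[E] E × E where
  toFun := g0 u
  map_add' := g0_add u
  map_smul' := g0_smul u

omit [StarRing E] in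
/-- `g₀` is the identity on the second line and multiplication by `u⁻¹` on the first. -/
theorem g0Linear_apply (u : E) (v : E × E) : g0Linear u v = (u⁻¹ * v.1, v.2) := rfl

omit [StarRing E] in
/-- For `u ≠ 0`, `g₀` is bijective (inverse `(x, y) ↦ (u x, y)`). -/
theorem g0_bijective {u : E} (hu0 : u ≠ 0) : Function.Bijective (g0 u) := by
  refine ⟨fun v w h => ?_, fun w => ⟨(u * w.1, w.2), ?_⟩⟩
  · have h1 := congrArg Prod.fst h
    have h2 := congrArg Prod.snd h
    simp only [g0_fst, g0_snd] at h1 h2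
    exact Prod.ext (mul_left_cancel₀ (inv_ne_zero hu0) h1) h2
  · ext
    · simp [g0, ← mul_assoc, inv_mul_cancel₀ hu0]
    · rfl

/-- `star u = u` gives `star u⁻¹ = u⁻¹`. -/
theorem star_inv_of_star_eq {u : E} (hu : star u = u) : star u⁻¹ = u⁻¹ := by
  rw [star_inv₀, hu]

/-- **The similitude identity of row N2.2.11.**  With `e₁₀₁ = u e₁₁₁`, `e₁₁₀ = u⁻¹ e₁₀₀` and
`u` fixed by the involution (`u ∈ F⁺ˣ`), `⟨g₀ v, g₀ w⟩_B = u⁻¹ ⟨v, w⟩_A`: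
`g₀` is a similitude of multiplier `u⁻¹` carrying the `111`-line to the `101`-line and the
`100`-line to the `110`-line. -/
theorem pairForm_g0 {u : E} (hu : star u = u) (hu0 : u ≠ 0) (e e' : E) (v w : E × E) :
    pairForm (u * e) (u⁻¹ * e') (g0 u v) (g0 u w) = u⁻¹ * pairForm e e' v w := by
  simp only [pairForm, lineForm, g0, star_mul', star_inv_of_star_eq hu]
  field_simp

/-- The two lines separately: `⟨g₀(x e₁₁₁), g₀(x' e₁₁₁)⟩ = u⁻¹ x x̄' e₁₁₁`. -/
theorem lineForm_first {u : E} (hu : star u = u) (hu0 : u ≠ 0) (e x x' : E) :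
    lineForm (u * e) (u⁻¹ * x) (u⁻¹ * x') = u⁻¹ * lineForm e x x' := by
  simp only [lineForm, star_mul', star_inv_of_star_eq hu]
  field_simp

/-- …and `⟨y e₁₁₀, y' e₁₁₀⟩ = y ȳ' u⁻¹ e₁₀₀ = u⁻¹ ⟨y e₁₀₀, y' e₁₀₀⟩`. -/
theorem lineForm_second (u e' y y' : E) :
    lineForm (u⁻¹ * e') y y' = u⁻¹ * lineForm e' y y' := by
  simp only [lineForm]; ring

omit [StarRing E] in
/-- «`e₁₀₁ e₁₁₀ = e₁₁₁ e₁₀₀` exactly» (N2.1(b)): `(u e)(u⁻¹ e') = e e'`. -/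
theorem mul_inv_mul_eq {u : E} (hu0 : u ≠ 0) (e e' : E) : (u * e) * (u⁻¹ * e') = e * e' := by
  rw [mul_mul_mul_comm, mul_inv_cancel₀ hu0, one_mul]

/-- The line form is skew-hermitian when the generator is trace-zero (`star e = -e`). -/
theorem star_lineForm {e : E} (he : star e = -e) (x y : E) :
    star (lineForm e x y) = - lineForm e y x := by
  simp only [lineForm, star_mul', star_star, he]
  ring

/-- The pair form is skew-hermitian when both generators are trace-zero. -/
theorem star_pairForm {e e' : E} (he : star e = -e) (he' : star e' = -e') (v w : E × E) :
    star (pairForm e e' v w) = - pairForm e e' w v := by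
  simp only [pairForm, star_add, star_lineForm he, star_lineForm he']
  ring

/-- The scaled generator `u e` is again trace-zero when `u` is fixed by the involution. -/
theorem star_mul_eq_neg {u e : E} (hu : star u = u) (he : star e = -e) :
    star (u * e) = -(u * e) := by
  rw [star_mul', hu, he, mul_neg]

/-- …and so is `u⁻¹ e'`. -/
theorem star_inv_mul_eq_neg {u e' : E} (hu : star u = u) (he' : star e' = -e') :
    star (u⁻¹ * e') = -(u⁻¹ * e') := by
  rw [star_mul', star_inv_of_star_eq hu, he', mul_neg]

/-- `δ` trace-zero ⇒ `δ² = -(δ · star δ)`, i.e. `δ² = -N(δ)` (row N2.2.9). -/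
theorem sq_eq_neg_mul_star {δ : E} (hδ : star δ = -δ) : δ ^ 2 = -(δ * star δ) := by
  rw [hδ]; ring

/-- `δ⁻¹ · (skew-hermitian)` is hermitian: the δ-scaling of row N2.2.2's `[A]`. -/
theorem star_inv_mul_pairForm {δ e e' : E} (hδ : star δ = -δ) (he : star e = -e)
    (he' : star e' = -e') (v w : E × E) :
    star (δ⁻¹ * pairForm e e' v w) = δ⁻¹ * pairForm e e' w v := by
  rw [star_mul', star_inv₀, hδ, star_pairForm he he', inv_neg]
  ring

omit [StarRing E] in
/-- The determinant of a diagonal `2 × 2` matrix is the product of its entries. -/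
theorem det_diagonal_pair (a b : E) : (Matrix.diagonal ![a, b]).det = a * b := by
  rw [Matrix.det_diagonal, Fin.prod_univ_two]
  simp

/-- **Row N2.2.9:** the determinant of the hermitian form `δ⁻¹(⟨e⟩ ⊥ ⟨e'⟩)`, the diagonal
matrix `diag(δ⁻¹ e, δ⁻¹ e')`, is `e e'/δ² = -e e'/N(δ)` with `N(δ) = δ · star δ`. -/
theorem det_scaled {δ : E} (hδ : star δ = -δ) (hδ0 : δ ≠ 0) (e e' : E) :
    (Matrix.diagonal ![δ⁻¹ * e, δ⁻¹ * e']).det = -(e * e') / (δ * star δ) := by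
  rw [det_diagonal_pair, hδ]
  field_simp

omit [StarRing E] in
/-- **Row N2.2.9, conclusion:** the two pairs of the datum have literally the same determinant,
`(δ⁻¹ e₁₀₁)(δ⁻¹ e₁₁₀) = (δ⁻¹ e₁₁₁)(δ⁻¹ e₁₀₀)` — before any passage to classes modulo norms. -/
theorem det_scaled_eq {u : E} (hu0 : u ≠ 0) (δ e e' : E) :
    (Matrix.diagonal ![δ⁻¹ * (u * e), δ⁻¹ * (u⁻¹ * e')]).det =
      (Matrix.diagonal ![δ⁻¹ * e, δ⁻¹ * e']).det := by
  rw [det_diagonal_pair, det_diagonal_pair]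
  field_simp

end StarRingModel

/-! ## 2. The sign-vector model: vertex types, admissibility, signatures -/

section SignModel

/-- A CM type of the cyclic sextic field, as a bit-string on its three complex places. -/
abbrev VertexType := Fin 3 → Bool

/-- A real sign vector at the three real places of `F⁺`. -/
abbrev SignVec := Fin 3 → SignType

/-- The vertex `111 = {τ₁, τ₂, τ₃}`. -/
def t111 : VertexType := ![true, true, true]

/-- The vertex `100 = {τ₁, τ̄₂, τ̄₃}`. -/
def t100 : VertexType := ![true, false, false]

/-- The vertex `101 = {τ₁, τ̄₂, τ₃}`. -/
def t101 : VertexType := ![true, false, true]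

/-- The vertex `110 = {τ₁, τ₂, τ̄₃}`. -/
def t110 : VertexType := ![true, true, false]

/-- The sign vector `(−, −, −)` of `e₁₁₁` (N2.1(b)). -/
def s111 : SignVec := ![SignType.neg, SignType.neg, SignType.neg]

/-- The sign vector `(−, +, +)` of `e₁₀₀` (N2.1(b)). -/
def s100 : SignVec := ![SignType.neg, SignType.pos, SignType.pos]

/-- The sign vector `(+, −, +)` of `u ∈ F⁺ˣ` (N2.1(b)). -/
def sU : SignVec := ![SignType.pos, SignType.neg, SignType.pos]

/-- The sign vector of `e₁₀₁ = u e₁₁₁`: the pointwise product. -/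
def s101 : SignVec := sU * s111

/-- The sign vector of `e₁₁₀ = u⁻¹ e₁₀₀`: the pointwise product (`u⁻¹` has the signs of `u`). -/
def s110 : SignVec := sU * s100

/-- Computed: `s101 = (−, +, −)` (row N2.2.8: «`(+,−,+)·(−,−,−) = (−,+,−)`»). -/
theorem s101_eq : s101 = ![SignType.neg, SignType.pos, SignType.neg] := by decide

/-- Computed: `s110 = (−, −, +)` (row N2.2.8: «`(+,−,+)·(−,+,+) = (−,−,+)`»). -/
theorem s110_eq : s110 = ![SignType.neg, SignType.neg, SignType.pos] := by decide

/-- The sign side of Liu's Def. 4.12 for a representative `e` and a type `t`: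
`Im τ′(e) < 0` for every `τ′` in the type, i.e. `e` is negative at the places where the
chosen representative `τ_j` is in the type (bit `true`) and positive where `τ̄_j` is
(bit `false`, since `Im τ̄_j(e) = -Im τ_j(e)`). -/
def Admissible (s : SignVec) (t : VertexType) : Prop :=
  ∀ j, s j = SignType.neg ↔ t j = true

/-- `Admissible` is decidable (three places, finitely many signs and bits). -/
instance instDecidableAdmissible (s : SignVec) (t : VertexType) : Decidable (Admissible s t) := by
  unfold Admissible; infer_instance

/-- `e₁₁₁` is admissible for `111`. -/
theorem admissible_111 : Admissible s111 t111 := by decide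

/-- `e₁₀₀` is admissible for `100`. -/
theorem admissible_100 : Admissible s100 t100 := by decide

/-- **Row N2.2.8:** `e₁₀₁ = u e₁₁₁` is admissible for `101`: negative exactly at `ι₁, ι₃`. -/
theorem admissible_101 : Admissible s101 t101 := by decide

/-- **Row N2.2.8:** `e₁₁₀ = u⁻¹ e₁₀₀` is admissible for `110`: negative exactly at `ι₁, ι₂`. -/
theorem admissible_110 : Admissible s110 t110 := by decide

/-- The number of negative entries among `(s j, s' j)`. -/
def negCount (s s' : SignVec) (j : Fin 3) : ℕ :=
  (if s j = SignType.neg then 1 else 0) + (if s' j = SignType.neg then 1 else 0)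

/-- The signature `(p, q)` = (#positive, #negative) at the real place `j` of `⟨e⟩ ⊥ ⟨e'⟩`,
for trace-zero generators with sign vectors `s, s'` (no zero entries). -/
def signature (s s' : SignVec) (j : Fin 3) : ℕ × ℕ :=
  (2 - negCount s s' j, negCount s s' j)

/-- **Row N2.2.6, pair A:** `W_A = ⟨e₁₁₁⟩ ⊥ ⟨e₁₀₀⟩` has signatures `(0,2), (1,1), (1,1)`. -/
theorem signature_A : signature s111 s100 = ![(0, 2), (1, 1), (1, 1)] := by decide

/-- **Row N2.2.6, pair B:** `W_B = ⟨e₁₀₁⟩ ⊥ ⟨e₁₁₀⟩` has signatures `(0,2), (1,1), (1,1)`. -/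
theorem signature_B : signature s101 s110 = ![(0, 2), (1, 1), (1, 1)] := by decide

/-- **Row N2.2.6:** the two pairs have the same signature at every real place. -/
theorem signature_A_eq_B : signature s111 s100 = signature s101 s110 := by decide

/-- **Row N2.2.12:** `u` (hence the multiplier `ν(g) = u⁻¹`) is negative exactly at `ι₂`. -/
theorem sU_neg_iff (j : Fin 3) : sU j = SignType.neg ↔ j = 1 := by
  revert j; decide

/-- The pointwise core: if `a` is admissible for the bit `b`, `σ a` for the bit `c`, and neither
`a` nor `σ` vanishes, then `σ` is negative exactly when the two bits differ. -/
theorem neg_iff_ne_of_admissible (a σ : SignType) (b c : Bool) (ha : a ≠ 0) (hσ : σ ≠ 0)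
    (h1 : a = SignType.neg ↔ b = true) (h2 : σ * a = SignType.neg ↔ c = true) :
    σ = SignType.neg ↔ b ≠ c := by
  revert a σ b c; decide

/-- **Lemma N.2, the structural reason for `u`'s signs:** if `s` is admissible for `t`, `σ * s`
is admissible for `t'`, and no entry vanishes, then the real factor `σ` is negative exactly at
the places where the two types differ. -/
theorem admissible_mul_neg_iff {s σ : SignVec} {t t' : VertexType}
    (hs : Admissible s t) (hs' : Admissible (σ * s) t')
    (hne : ∀ j, s j ≠ 0) (hneσ : ∀ j, σ j ≠ 0) (j : Fin 3) :
    σ j = SignType.neg ↔ t j ≠ t' j :=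
  neg_iff_ne_of_admissible (s j) (σ j) (t j) (t' j) (hne j) (hneσ j) (hs j) (hs' j)

/-- The types `111` and `101` differ exactly at the second place… -/
theorem t111_ne_t101_iff (j : Fin 3) : t111 j ≠ t101 j ↔ j = 1 := by
  revert j; decide

/-- …and so do `100` and `110`: ONE real factor `u` serves both lines of the datum. -/
theorem t100_ne_t110_iff (j : Fin 3) : t100 j ≠ t110 j ↔ j = 1 := by
  revert j; decide

/-- The consistency behind Lemma N.2: `111 xor 101 = 100 xor 110` as bit-strings. -/
theorem xor_consistency : (fun j => xor (t111 j) (t101 j)) = fun j => xor (t100 j) (t110 j) := by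
  decide

end SignModel

/-! ## 3. From real numbers to sign vectors -/

section RealSigns

/-- The sign vector of a triple of real numbers. -/
noncomputable def signVec (x : Fin 3 → ℝ) : SignVec := fun j => SignType.sign (x j)

/-- The sign vector of a product is the product of the sign vectors (`sign_mul`). -/
theorem signVec_mul (x y : Fin 3 → ℝ) : signVec (x * y) = signVec x * signVec y := by
  funext j
  simp only [signVec, Pi.mul_apply, sign_mul]

/-- Inversion does not change signs: `ν(g) = u⁻¹` has the sign vector of `u`. -/
theorem sign_inv_eq (x : ℝ) : SignType.sign x⁻¹ = SignType.sign x := by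
  rcases lt_trichotomy x 0 with h | h | h
  · simp [h, inv_lt_zero.mpr h]
  · simp [h]
  · simp [h, inv_pos.mpr h]

/-- The sign vector of `u⁻¹` is the sign vector of `u`. -/
theorem signVec_inv (x : Fin 3 → ℝ) : signVec (fun j => (x j)⁻¹) = signVec x := by
  funext j
  simp only [signVec, sign_inv_eq]

/-- A triple of non-zero reals has a sign vector without zero entries. -/
theorem signVec_ne_zero {x : Fin 3 → ℝ} (hx : ∀ j, x j ≠ 0) (j : Fin 3) : signVec x j ≠ 0 := by
  simp only [signVec]
  exact fun h => hx j (sign_eq_zero_iff.mp h)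

end RealSigns

end Summit.Ventures.HodgeRepro2.T5DatumSimilitude
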